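import Literature.NumberTheory.Rogawski1990.LocalNormFibreNonsplit    -- ★ (F0P3a-p08): (F2) `isLocalStablyConjH_of_isLocalNormPair_of_snd_eq`, (F3) `IsLocalStablyConjH.snd_eq` (norm fibre ↔ `U(Φ₁)`-slot)
import Literature.NumberTheory.Rogawski1990.CMLocalAPacketMembers      -- ★ `Gqs`, `qsForm` (the quasi-split `G_v` carrier of the (E8)∕(E0) letters)
import HarnessLib

/-!
# F0 · P3c · ROAD «ELL-INNER» — brick (E2) «FIBRE-ENUM»: the stable norm fibre over a compact `H`-Cartan is the image of the slot maps, and its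
# cardinality letter `hcQ` (LEAD T14-40 fence (α)) [Rogawski1990 §5.4 p. 78; §3.6 Lemma 3.6.1 p. 31; §3.7 Prop. 3.7.1; §12.5 Prop. 12.5.2 pp. 183–185]

Cell `pub/hodgecm-mathlib`, crux H413 = `stmt-HodgeConjecture-24833` (lane `--supports … --as helper`), route HCCMUnconditional; ROAD «ELL-INNER» (LEAD F0P3a-plan (g15)
T14-40∕T14-44; map owner ∕ E-dealer LH6-p03 (g7), deal 2026-09-02T20:19:27Z «(E2) FIBRE-ENUM → LH10-p02»); seat LH10-p02 (g11).  THEOREMS ONLY (no definition ∕ instance ∕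
notation ∕ named fact ∕ `sorry`); ★-only imports.  Census `F0/P3c/LH10/LH10-p02/g11/e2/CENSUS-E2.v1.LH10p02g11.md`.

WHAT.  The (E0) «G-REGROUP» head of the road (LH6-p03, `F0P3cStCharTSEllInnerGRegroup.ellipticTorusSum_eq_weightedSum_embedding`) carries the THEOREM-LEVEL count letter
```
hcQ : ∀ T ∈ SH, ∀ (i : Fin (n T)) (s : ↥T), IsLocalGRegular L v s.1 →
  ∃ Q : Finset H_v, (∀ q ∈ Q, IsLocalGRegular L v q ∧ IsLocalNormPair L (qsForm L) v q ↑(eT T i s)) ∧ (∀ q ∈ Q, ∀ q' ∈ Q, IsLocalStablyConjH L v q q' → q = q') ∧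
    (∀ a, IsLocalGRegular L v a → IsLocalNormPair L (qsForm L) v a ↑(eT T i s) → ∃ q ∈ Q, IsLocalStablyConjH L v a q) ∧ Q.card = cQ T
```
(«the `G`-regular stable norm fibre of `eT T i s` has exactly `cQ T` `H`-stable classes, for EVERY `i` and EVERY `G`-regular `s ∈ T`» — fence (α): discharged as a theorem,
never a leaf antecedent), and the (E8) assembly (F0P3a-p06 sigsheet 2491f5c6 :138–:144) carries the SLOT letters of (E2b) «SLOT-AUT» (F0P3a-p03): `cQ`, `σ : (T) → Fin (cQ T) → (↥T → ↥T)`,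
`hσreg` (slots are `G`-regular), `hσR` (every slot of `s` matches every `eT T i s`), `hσpair` (distinct slots are NOT stably conjugate), `hσexh` (every `G`-regular member of the
fibre is stably conjugate to a slot).  This file is the bridge, in those letters token for token:

* §1 GENERIC (any types, any predicates): `exists_transversal_of_slots` — a reflexive relation `st`, a `Fin c`-indexed family of pairwise non-`st`-related «slots» inside a
  fibre, `st`-exhausting it ⇒ the fibre has a transversal `Q` (the image of the slots) with `Q.card = c`.  Pure finite bookkeeping.
* §2 `hcQ_of_slots` — the (E0) letter `hcQ` VERBATIM from `(cQ σ hσreg hσR hσpair hσexh)` (p06 :138–:144 verbatim): `Q := univ.image (fun u => ↑(σ T u s))`.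
* §3 the SLOT-LEVEL clauses of the (E2b) ∃-package (F0P3a-p03 `CENSUS-E2b-SlotAut.v1` §1: (G) slots `G`-regular, (N) slots match what `s` matches, (D) distinct `U(Φ₁)`-entries
  `finGammaTwo`, (R) the `U(Φ₁)`-entries enumerate the roots of `charpoly ι_v(s)`) turned into `hσR` ∕ `hσpair` ∕ `hσexh` through the ★ norm-fibre dictionary
  (`LocalNormFibreNonsplit` §1 `IsLocalNormPair.charpoly_eq` ∕ `.isRoot_finGammaTwo`, (F2) `isLocalStablyConjH_of_isLocalNormPair_of_finGammaTwo_eq`, (F3)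
  `IsLocalStablyConjH.finGammaTwo_eq`) [Rogawski1990 §5.4 p. 78: the stable classes of `H` over a class «are told apart by the `U(1)`-slot»]:
  `hσR_of_slotClauseN`, `hσpair_of_slotClauseD`, `hσexh_of_slotClauseR`.
* §4 ONE-STOP `hcQ_of_slotClauses` — `hcQ` straight from (G)(N)(D)(R) + the embedding letter `heT` (= §2 ∘ §3).
HONEST LABEL: count-neutral helper of ROAD «ELL-INNER»; `𝔇.Prop1252` stays a PRINTED consequent of `hBlock′` until the road's ★ rider; HC_CM is proved only modulo the 7 printed
citations (2 remaining named inputs: hLiu418 = `stmt-HodgeConjecture-24832`, h413 = `stmt-HodgeConjecture-24833`) until rung 0 closes.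

## References
* [Rogawski1990] J. D. Rogawski, *Automorphic Representations of Unitary Groups in Three Variables*, Ann. of Math. Stud. 123 (1990): §3.1 p. 19 (stable conjugacy), §3.6
  Lemma 3.6.1 p. 31, §3.7 Prop. 3.7.1 p. 31 (`Ω_F(T,G) ∕ Ω_F(T,H)`), §4.3 (4.3.1)–(4.3.2) pp. 42–43 (`γ_H → γ`), §5.4 p. 78 (three stable classes of `H` over a class of type `(E¹)³`),
  §12.5 Prop. 12.5.2 pp. 183–185.
* [LanglandsShelstad1987] R. P. Langlands, D. Shelstad, *On the definition of transfer factors*, Math. Ann. 278 (1987), §1.3.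
-/

set_option autoImplicit false
-- the mandated namespace has the single-problem summit's repeated segment (`HodgeConjecture.HodgeConjecture`)
set_option linter.dupNamespace false

noncomputable section

open NumberField IsDedekindDomain
open scoped Matrix MatrixGroups
open Literature.NumberTheory.Rogawski1990 Literature.NumberTheory.Automorphic Literature.NumberTheory.Automorphic.UnitaryGroup

namespace Summit.HodgeConjecture.HodgeConjecture.Cruxes.H413.F0P3cStCharTSEllInnerFibreEnum

/-! ## §1 Generic: a transversal from an indexed family of slots -/

section Generic

variable {X : Type*} {reg : X → Prop} {match_ : X → Prop} {st : X → X → Prop}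

/-- **A TRANSVERSAL FROM SLOTS** (pure bookkeeping).  Let `st` be a reflexive relation on `X` («stably conjugate»), `reg`∕`match_` predicates («`G`-regular», «matches `x`»), and
`slot : Fin c → X` a family of `reg`, `match_` elements, pairwise NOT `st`-related, such that every `reg`, `match_` element is `st`-related to some slot.  Then the image
`Q` of `slot` is a transversal: its members are `reg` and `match_`, `st`-related members are equal, every `reg` `match_` element is `st`-related to a member, and
`Q.card = c`. [cite: Rogawski1990, §5.4 p. 78] -/
theorem exists_transversal_of_slots [DecidableEq X] (hst : ∀ a : X, st a a) {c : ℕ} (slot : Fin c → X)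
    (hreg : ∀ u, reg (slot u)) (hmatch : ∀ u, match_ (slot u)) (hpair : ∀ u u' : Fin c, u ≠ u' → ¬ st (slot u) (slot u'))
    (hexh : ∀ a : X, reg a → match_ a → ∃ u : Fin c, st a (slot u)) :
    ∃ Q : Finset X, (∀ q ∈ Q, reg q ∧ match_ q) ∧ (∀ q ∈ Q, ∀ q' ∈ Q, st q q' → q = q') ∧ (∀ a : X, reg a → match_ a → ∃ q ∈ Q, st a q) ∧ Q.card = c := by
  have hinj : Function.Injective slot := by
    intro u u' h
    by_contra hne
    exact hpair u u' hne (h ▸ hst (slot u))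
  refine ⟨Finset.univ.image slot, ?_, ?_, ?_, ?_⟩
  · intro q hq
    obtain ⟨u, -, rfl⟩ := Finset.mem_image.1 hq
    exact ⟨hreg u, hmatch u⟩
  · intro q hq q' hq' hqq'
    obtain ⟨u, -, rfl⟩ := Finset.mem_image.1 hq
    obtain ⟨u', -, rfl⟩ := Finset.mem_image.1 hq'
    by_cases huu' : u = u'
    · rw [huu']
    · exact absurd hqq' (hpair u u' huu')
  · intro a ha hm
    obtain ⟨u, hu⟩ := hexh a ha hm
    exact ⟨slot u, Finset.mem_image.2 ⟨u, Finset.mem_univ _, rfl⟩, hu⟩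
  · rw [Finset.card_image_of_injective _ hinj, Finset.card_univ, Fintype.card_fin]

end Generic

/-! ## §2 The (E0) letter `hcQ` from the (E2b) slot letters -/

section CM

variable (L : Type) [Field L] [NumberField L] [IsCMField L] (v : HeightOneSpectrum (𝓞 ↥(maximalRealSubfield L)))

/-- **(E2) «FIBRE-ENUM»: the count letter `hcQ` of the (E0) «G-REGROUP» head, from the (E2b) slot letters `cQ σ hσreg hσR hσpair hσexh`** (token for token the (E8) sigsheet's
:138–:144 and the (E0) head's `hcQ`).  For every member `T ∈ SH`, every embedding index `i` and every `G`-regular `s ∈ T`, the `G`-regular stable norm fibre of `eT T i s` — the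
`G`-regular `a ∈ H_v` with `a → eT T i s` in the sense of (4.3.1), up to stable conjugacy in `H_v` — is enumerated by the `cQ T` slots `σ T u s`: `Q := {↑(σ T u s) | u}` is a
transversal with `Q.card = cQ T` («three stable conjugacy classes in `H` which transfer to `γ₀`» on type `(E¹)³`, one on the other compact type).  This is LEAD T14-40 fence (α):
the count is a THEOREM about `T`, the same for every `i` and every `G`-regular `s ∈ T`. [cite: Rogawski1990, §5.4 p. 78; §3.7 Prop. 3.7.1 p. 31; §12.5 p. 185] -/
theorem hcQ_of_slots
    (SH : Finset (Subgroup ((UnitaryGroup.cmDatum L 2 (Matrix.of fun i j : Fin 2 => if i.val + j.val + 1 = 2 then (1 : L) else 0)).Local v × (UnitaryGroup.cmDatum L 1 (Matrix.of fun i j : Fin 1 => if i.val + j.val + 1 = 1 then (1 : L) else 0)).Local v)))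
    (n : Subgroup ((UnitaryGroup.cmDatum L 2 (Matrix.of fun i j : Fin 2 => if i.val + j.val + 1 = 2 then (1 : L) else 0)).Local v × (UnitaryGroup.cmDatum L 1 (Matrix.of fun i j : Fin 1 => if i.val + j.val + 1 = 1 then (1 : L) else 0)).Local v) → ℕ)
    (γc : (T : Subgroup ((UnitaryGroup.cmDatum L 2 (Matrix.of fun i j : Fin 2 => if i.val + j.val + 1 = 2 then (1 : L) else 0)).Local v × (UnitaryGroup.cmDatum L 1 (Matrix.of fun i j : Fin 1 => if i.val + j.val + 1 = 1 then (1 : L) else 0)).Local v)) → Fin (n T) → Gqs L v)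
    (eT : (T : Subgroup ((UnitaryGroup.cmDatum L 2 (Matrix.of fun i j : Fin 2 => if i.val + j.val + 1 = 2 then (1 : L) else 0)).Local v × (UnitaryGroup.cmDatum L 1 (Matrix.of fun i j : Fin 1 => if i.val + j.val + 1 = 1 then (1 : L) else 0)).Local v)) → (i : Fin (n T)) → (↥T ≃ₜ* ↥(Subgroup.centralizer ({γc T i} : Set (Gqs L v)))))
    (cQ : Subgroup ((UnitaryGroup.cmDatum L 2 (Matrix.of fun i j : Fin 2 => if i.val + j.val + 1 = 2 then (1 : L) else 0)).Local v × (UnitaryGroup.cmDatum L 1 (Matrix.of fun i j : Fin 1 => if i.val + j.val + 1 = 1 then (1 : L) else 0)).Local v) → ℕ) (σ : (T : Subgroup ((UnitaryGroup.cmDatum L 2 (Matrix.of fun i j : Fin 2 => if i.val + j.val + 1 = 2 then (1 : L) else 0)).Local v × (UnitaryGroup.cmDatum L 1 (Matrix.of fun i j : Fin 1 => if i.val + j.val + 1 = 1 then (1 : L) else 0)).Local v)) → Fin (cQ T) → (↥T → ↥T))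
    (hσreg : ∀ T ∈ SH, ∀ (u : Fin (cQ T)) (s : ↥T), IsLocalGRegular L v (s : ((UnitaryGroup.cmDatum L 2 (Matrix.of fun i j : Fin 2 => if i.val + j.val + 1 = 2 then (1 : L) else 0)).Local v × (UnitaryGroup.cmDatum L 1 (Matrix.of fun i j : Fin 1 => if i.val + j.val + 1 = 1 then (1 : L) else 0)).Local v)) → IsLocalGRegular L v (σ T u s : ((UnitaryGroup.cmDatum L 2 (Matrix.of fun i j : Fin 2 => if i.val + j.val + 1 = 2 then (1 : L) else 0)).Local v × (UnitaryGroup.cmDatum L 1 (Matrix.of fun i j : Fin 1 => if i.val + j.val + 1 = 1 then (1 : L) else 0)).Local v)))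
    (hσR : ∀ T ∈ SH, ∀ (u : Fin (cQ T)) (i : Fin (n T)) (s : ↥T), IsLocalGRegular L v (s : ((UnitaryGroup.cmDatum L 2 (Matrix.of fun i j : Fin 2 => if i.val + j.val + 1 = 2 then (1 : L) else 0)).Local v × (UnitaryGroup.cmDatum L 1 (Matrix.of fun i j : Fin 1 => if i.val + j.val + 1 = 1 then (1 : L) else 0)).Local v)) → IsLocalNormPair L (qsForm L) v (σ T u s).1 ((eT T i s : ↥(Subgroup.centralizer ({γc T i} : Set (Gqs L v)))) : Gqs L v))
    (hσpair : ∀ T ∈ SH, ∀ (s : ↥T), IsLocalGRegular L v (s : ((UnitaryGroup.cmDatum L 2 (Matrix.of fun i j : Fin 2 => if i.val + j.val + 1 = 2 then (1 : L) else 0)).Local v × (UnitaryGroup.cmDatum L 1 (Matrix.of fun i j : Fin 1 => if i.val + j.val + 1 = 1 then (1 : L) else 0)).Local v)) → ∀ u u' : Fin (cQ T), u ≠ u' → ¬ IsLocalStablyConjH L v (σ T u s).1 (σ T u' s).1)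
    (hσexh : ∀ T ∈ SH, ∀ (i : Fin (n T)) (s : ↥T), IsLocalGRegular L v (s : ((UnitaryGroup.cmDatum L 2 (Matrix.of fun i j : Fin 2 => if i.val + j.val + 1 = 2 then (1 : L) else 0)).Local v × (UnitaryGroup.cmDatum L 1 (Matrix.of fun i j : Fin 1 => if i.val + j.val + 1 = 1 then (1 : L) else 0)).Local v)) → ∀ a : ((UnitaryGroup.cmDatum L 2 (Matrix.of fun i j : Fin 2 => if i.val + j.val + 1 = 2 then (1 : L) else 0)).Local v × (UnitaryGroup.cmDatum L 1 (Matrix.of fun i j : Fin 1 => if i.val + j.val + 1 = 1 then (1 : L) else 0)).Local v), IsLocalGRegular L v a → IsLocalNormPair L (qsForm L) v a ((eT T i s : ↥(Subgroup.centralizer ({γc T i} : Set (Gqs L v)))) : Gqs L v) →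
      ∃ u : Fin (cQ T), IsLocalStablyConjH L v a (σ T u s).1) :
    ∀ T ∈ SH, ∀ (i : Fin (n T)) (s : ↥T), IsLocalGRegular L v s.1 →
      ∃ Q : Finset ((UnitaryGroup.cmDatum L 2 (Matrix.of fun i j : Fin 2 => if i.val + j.val + 1 = 2 then (1 : L) else 0)).Local v × (UnitaryGroup.cmDatum L 1 (Matrix.of fun i j : Fin 1 => if i.val + j.val + 1 = 1 then (1 : L) else 0)).Local v), (∀ q ∈ Q, IsLocalGRegular L v q ∧ IsLocalNormPair L (qsForm L) v q ((eT T i s : ↥(Subgroup.centralizer ({γc T i} : Set (Gqs L v)))) : Gqs L v)) ∧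
        (∀ q ∈ Q, ∀ q' ∈ Q, IsLocalStablyConjH L v q q' → q = q') ∧
        (∀ a : ((UnitaryGroup.cmDatum L 2 (Matrix.of fun i j : Fin 2 => if i.val + j.val + 1 = 2 then (1 : L) else 0)).Local v × (UnitaryGroup.cmDatum L 1 (Matrix.of fun i j : Fin 1 => if i.val + j.val + 1 = 1 then (1 : L) else 0)).Local v), IsLocalGRegular L v a → IsLocalNormPair L (qsForm L) v a ((eT T i s : ↥(Subgroup.centralizer ({γc T i} : Set (Gqs L v)))) : Gqs L v) → ∃ q ∈ Q, IsLocalStablyConjH L v a q) ∧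
        Q.card = cQ T := by
  classical
  intro T hT i s hs
  exact exists_transversal_of_slots (reg := IsLocalGRegular L v)
    (match_ := fun q => IsLocalNormPair L (qsForm L) v q ((eT T i s : ↥(Subgroup.centralizer ({γc T i} : Set (Gqs L v)))) : Gqs L v))
    (st := IsLocalStablyConjH L v) (fun a => IsStablyConjH.refl _ _ _ a) (fun u => (σ T u s).1)
    (fun u => hσreg T hT u s hs) (fun u => hσR T hT u i s hs) (hσpair T hT s hs) (hσexh T hT i s hs)

/-! ## §3 The slot-level clauses of (E2b) «SLOT-AUT» (F0P3a-p03 census `CENSUS-E2b-SlotAut.v1` §1 letters (G)(N)(D)(R)) ⇒ `hσR`, `hσpair`, `hσexh`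
through the ★ norm-fibre dictionary (`LocalNormFibreNonsplit` §1–§3: inside a norm fibre, the `H`-stable class IS the `U(Φ₁)`-slot `u = finGammaTwo`) -/

/-- **`hσR` FROM (N)**: a slot of `s` matches everything `s` matches; `s` matches `eT T i s` (`heT`). [cite: Rogawski1990, §4.3 (4.3.1) p. 43] -/
theorem hσR_of_slotClauseN
    (SH : Finset (Subgroup ((UnitaryGroup.cmDatum L 2 (Matrix.of fun i j : Fin 2 => if i.val + j.val + 1 = 2 then (1 : L) else 0)).Local v × (UnitaryGroup.cmDatum L 1 (Matrix.of fun i j : Fin 1 => if i.val + j.val + 1 = 1 then (1 : L) else 0)).Local v)))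
    (n : Subgroup ((UnitaryGroup.cmDatum L 2 (Matrix.of fun i j : Fin 2 => if i.val + j.val + 1 = 2 then (1 : L) else 0)).Local v × (UnitaryGroup.cmDatum L 1 (Matrix.of fun i j : Fin 1 => if i.val + j.val + 1 = 1 then (1 : L) else 0)).Local v) → ℕ)
    (γc : (T : Subgroup ((UnitaryGroup.cmDatum L 2 (Matrix.of fun i j : Fin 2 => if i.val + j.val + 1 = 2 then (1 : L) else 0)).Local v × (UnitaryGroup.cmDatum L 1 (Matrix.of fun i j : Fin 1 => if i.val + j.val + 1 = 1 then (1 : L) else 0)).Local v)) → Fin (n T) → Gqs L v)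
    (eT : (T : Subgroup ((UnitaryGroup.cmDatum L 2 (Matrix.of fun i j : Fin 2 => if i.val + j.val + 1 = 2 then (1 : L) else 0)).Local v × (UnitaryGroup.cmDatum L 1 (Matrix.of fun i j : Fin 1 => if i.val + j.val + 1 = 1 then (1 : L) else 0)).Local v)) → (i : Fin (n T)) → (↥T ≃ₜ* ↥(Subgroup.centralizer ({γc T i} : Set (Gqs L v)))))
    (heT : ∀ T ∈ SH, ∀ (i : Fin (n T)) (s : ↥T), IsLocalNormPair L (qsForm L) v s.1 ((eT T i s : ↥(Subgroup.centralizer ({γc T i} : Set (Gqs L v)))) : Gqs L v))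
    (cQ : Subgroup ((UnitaryGroup.cmDatum L 2 (Matrix.of fun i j : Fin 2 => if i.val + j.val + 1 = 2 then (1 : L) else 0)).Local v × (UnitaryGroup.cmDatum L 1 (Matrix.of fun i j : Fin 1 => if i.val + j.val + 1 = 1 then (1 : L) else 0)).Local v) → ℕ) (σ : (T : Subgroup ((UnitaryGroup.cmDatum L 2 (Matrix.of fun i j : Fin 2 => if i.val + j.val + 1 = 2 then (1 : L) else 0)).Local v × (UnitaryGroup.cmDatum L 1 (Matrix.of fun i j : Fin 1 => if i.val + j.val + 1 = 1 then (1 : L) else 0)).Local v)) → Fin (cQ T) → (↥T → ↥T))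
    (hN : ∀ T ∈ SH, ∀ (u : Fin (cQ T)) (s : ↥T) (γ : Gqs L v), IsLocalNormPair L (qsForm L) v s.1 γ → IsLocalNormPair L (qsForm L) v (σ T u s).1 γ) :
    ∀ T ∈ SH, ∀ (u : Fin (cQ T)) (i : Fin (n T)) (s : ↥T), IsLocalGRegular L v (s : ((UnitaryGroup.cmDatum L 2 (Matrix.of fun i j : Fin 2 => if i.val + j.val + 1 = 2 then (1 : L) else 0)).Local v × (UnitaryGroup.cmDatum L 1 (Matrix.of fun i j : Fin 1 => if i.val + j.val + 1 = 1 then (1 : L) else 0)).Local v)) → IsLocalNormPair L (qsForm L) v (σ T u s).1 ((eT T i s : ↥(Subgroup.centralizer ({γc T i} : Set (Gqs L v)))) : Gqs L v) :=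
  fun T hT u i s _ => hN T hT u s _ (heT T hT i s)

/-- **`hσpair` FROM (D)**: slots with distinct `U(Φ₁)`-entries `u = finGammaTwo` are not stably conjugate (stably conjugate elements of `H_v` have equal `U(Φ₁)`-components,
★ (F3) `IsLocalStablyConjH.finGammaTwo_eq`). [cite: Rogawski1990, §5.4 p. 78; §3.1 p. 19] -/
theorem hσpair_of_slotClauseD
    (SH : Finset (Subgroup ((UnitaryGroup.cmDatum L 2 (Matrix.of fun i j : Fin 2 => if i.val + j.val + 1 = 2 then (1 : L) else 0)).Local v × (UnitaryGroup.cmDatum L 1 (Matrix.of fun i j : Fin 1 => if i.val + j.val + 1 = 1 then (1 : L) else 0)).Local v)))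
    (cQ : Subgroup ((UnitaryGroup.cmDatum L 2 (Matrix.of fun i j : Fin 2 => if i.val + j.val + 1 = 2 then (1 : L) else 0)).Local v × (UnitaryGroup.cmDatum L 1 (Matrix.of fun i j : Fin 1 => if i.val + j.val + 1 = 1 then (1 : L) else 0)).Local v) → ℕ) (σ : (T : Subgroup ((UnitaryGroup.cmDatum L 2 (Matrix.of fun i j : Fin 2 => if i.val + j.val + 1 = 2 then (1 : L) else 0)).Local v × (UnitaryGroup.cmDatum L 1 (Matrix.of fun i j : Fin 1 => if i.val + j.val + 1 = 1 then (1 : L) else 0)).Local v)) → Fin (cQ T) → (↥T → ↥T))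
    (hD : ∀ T ∈ SH, ∀ (s : ↥T), IsLocalGRegular L v (s : ((UnitaryGroup.cmDatum L 2 (Matrix.of fun i j : Fin 2 => if i.val + j.val + 1 = 2 then (1 : L) else 0)).Local v × (UnitaryGroup.cmDatum L 1 (Matrix.of fun i j : Fin 1 => if i.val + j.val + 1 = 1 then (1 : L) else 0)).Local v)) → ∀ u u' : Fin (cQ T), u ≠ u' → finGammaTwo L v (σ T u s).1 ≠ finGammaTwo L v (σ T u' s).1) :
    ∀ T ∈ SH, ∀ (s : ↥T), IsLocalGRegular L v (s : ((UnitaryGroup.cmDatum L 2 (Matrix.of fun i j : Fin 2 => if i.val + j.val + 1 = 2 then (1 : L) else 0)).Local v × (UnitaryGroup.cmDatum L 1 (Matrix.of fun i j : Fin 1 => if i.val + j.val + 1 = 1 then (1 : L) else 0)).Local v)) → ∀ u u' : Fin (cQ T), u ≠ u' → ¬ IsLocalStablyConjH L v (σ T u s).1 (σ T u' s).1 :=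
  fun T hT s hs u u' huu' hst => hD T hT s hs u u' huu' (hst.finGammaTwo_eq L v)

/-- **`hσexh` FROM (R) + (N)**: a `G`-regular `a ∈ H_v` matching `eT T i s` has its `U(Φ₁)`-entry among the roots of `charpoly (eT T i s) = charpoly ι_v(s)` (★ §1
`IsLocalNormPair.isRoot_finGammaTwo` ∕ `.charpoly_eq`, ★ `charpoly_endoEmbLocal`), hence equal to a slot's entry by (R); same target class + same `U(Φ₁)`-entry ⇒ stably conjugate
(★ (F2) `isLocalStablyConjH_of_isLocalNormPair_of_finGammaTwo_eq`, the slot matching by (N) ∘ `heT`). [cite: Rogawski1990, §5.4 p. 78; §4.3 (4.3.1) p. 43] [cite: LanglandsShelstad1987, §1.3] -/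
theorem hσexh_of_slotClauseR
    (SH : Finset (Subgroup ((UnitaryGroup.cmDatum L 2 (Matrix.of fun i j : Fin 2 => if i.val + j.val + 1 = 2 then (1 : L) else 0)).Local v × (UnitaryGroup.cmDatum L 1 (Matrix.of fun i j : Fin 1 => if i.val + j.val + 1 = 1 then (1 : L) else 0)).Local v)))
    (n : Subgroup ((UnitaryGroup.cmDatum L 2 (Matrix.of fun i j : Fin 2 => if i.val + j.val + 1 = 2 then (1 : L) else 0)).Local v × (UnitaryGroup.cmDatum L 1 (Matrix.of fun i j : Fin 1 => if i.val + j.val + 1 = 1 then (1 : L) else 0)).Local v) → ℕ)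
    (γc : (T : Subgroup ((UnitaryGroup.cmDatum L 2 (Matrix.of fun i j : Fin 2 => if i.val + j.val + 1 = 2 then (1 : L) else 0)).Local v × (UnitaryGroup.cmDatum L 1 (Matrix.of fun i j : Fin 1 => if i.val + j.val + 1 = 1 then (1 : L) else 0)).Local v)) → Fin (n T) → Gqs L v)
    (eT : (T : Subgroup ((UnitaryGroup.cmDatum L 2 (Matrix.of fun i j : Fin 2 => if i.val + j.val + 1 = 2 then (1 : L) else 0)).Local v × (UnitaryGroup.cmDatum L 1 (Matrix.of fun i j : Fin 1 => if i.val + j.val + 1 = 1 then (1 : L) else 0)).Local v)) → (i : Fin (n T)) → (↥T ≃ₜ* ↥(Subgroup.centralizer ({γc T i} : Set (Gqs L v)))))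
    (heT : ∀ T ∈ SH, ∀ (i : Fin (n T)) (s : ↥T), IsLocalNormPair L (qsForm L) v s.1 ((eT T i s : ↥(Subgroup.centralizer ({γc T i} : Set (Gqs L v)))) : Gqs L v))
    (cQ : Subgroup ((UnitaryGroup.cmDatum L 2 (Matrix.of fun i j : Fin 2 => if i.val + j.val + 1 = 2 then (1 : L) else 0)).Local v × (UnitaryGroup.cmDatum L 1 (Matrix.of fun i j : Fin 1 => if i.val + j.val + 1 = 1 then (1 : L) else 0)).Local v) → ℕ) (σ : (T : Subgroup ((UnitaryGroup.cmDatum L 2 (Matrix.of fun i j : Fin 2 => if i.val + j.val + 1 = 2 then (1 : L) else 0)).Local v × (UnitaryGroup.cmDatum L 1 (Matrix.of fun i j : Fin 1 => if i.val + j.val + 1 = 1 then (1 : L) else 0)).Local v)) → Fin (cQ T) → (↥T → ↥T))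
    (hN : ∀ T ∈ SH, ∀ (u : Fin (cQ T)) (s : ↥T) (γ : Gqs L v), IsLocalNormPair L (qsForm L) v s.1 γ → IsLocalNormPair L (qsForm L) v (σ T u s).1 γ)
    (hR : ∀ T ∈ SH, ∀ (s : ↥T), IsLocalGRegular L v (s : ((UnitaryGroup.cmDatum L 2 (Matrix.of fun i j : Fin 2 => if i.val + j.val + 1 = 2 then (1 : L) else 0)).Local v × (UnitaryGroup.cmDatum L 1 (Matrix.of fun i j : Fin 1 => if i.val + j.val + 1 = 1 then (1 : L) else 0)).Local v)) → ∀ r : UnitaryGroup.LocalRing L v,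
      (((endoEmbLocal L v s.1).val.val : Matrix (Fin 3) (Fin 3) (UnitaryGroup.LocalRing L v)).charpoly).IsRoot r ↔ ∃ u : Fin (cQ T), finGammaTwo L v (σ T u s).1 = r) :
    ∀ T ∈ SH, ∀ (i : Fin (n T)) (s : ↥T), IsLocalGRegular L v (s : ((UnitaryGroup.cmDatum L 2 (Matrix.of fun i j : Fin 2 => if i.val + j.val + 1 = 2 then (1 : L) else 0)).Local v × (UnitaryGroup.cmDatum L 1 (Matrix.of fun i j : Fin 1 => if i.val + j.val + 1 = 1 then (1 : L) else 0)).Local v)) → ∀ a : ((UnitaryGroup.cmDatum L 2 (Matrix.of fun i j : Fin 2 => if i.val + j.val + 1 = 2 then (1 : L) else 0)).Local v × (UnitaryGroup.cmDatum L 1 (Matrix.of fun i j : Fin 1 => if i.val + j.val + 1 = 1 then (1 : L) else 0)).Local v), IsLocalGRegular L v a → IsLocalNormPair L (qsForm L) v a ((eT T i s : ↥(Subgroup.centralizer ({γc T i} : Set (Gqs L v)))) : Gqs L v) →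
      ∃ u : Fin (cQ T), IsLocalStablyConjH L v a (σ T u s).1 := by
  intro T hT i s hs a ha hmatch
  -- `u(a)` is a root of `charpoly (eT T i s) = χ_{s.1} · (X − u(s)) = charpoly ι_v(s)`
  have hroot : (((endoEmbLocal L v s.1).val.val : Matrix (Fin 3) (Fin 3) (UnitaryGroup.LocalRing L v)).charpoly).IsRoot (finGammaTwo L v a) := by
    rw [charpoly_endoEmbLocal, ← (heT T hT i s).charpoly_eq]
    exact hmatch.isRoot_finGammaTwo
  obtain ⟨u, hu⟩ := (hR T hT s hs (finGammaTwo L v a)).1 hroot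
  exact ⟨u, isLocalStablyConjH_of_isLocalNormPair_of_finGammaTwo_eq L (qsForm L) v ha hmatch (hN T hT u s _ (heT T hT i s)) hu.symm⟩

/-! ## §4 One-stop: the (E0) letter `hcQ` straight from the (E2b) clauses (G)(N)(D)(R) -/

/-- **(E2) «FIBRE-ENUM», ONE-STOP FORM: `hcQ` from the (E2b) ∃-package clauses (G) (slots `G`-regular), (N) (slots match what `s` matches), (D) (distinct `U(Φ₁)`-entries),
(R) (the `U(Φ₁)`-entries enumerate the roots of `charpoly ι_v(s)`)** and the embedding letter `heT`: for every `T ∈ SH`, every `i`, every `G`-regular `s ∈ T`, the `G`-regular stable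
norm fibre of `eT T i s` has a transversal of cardinality `cQ T` = the number of slots = the number of roots of `charpoly ι_v(s)` in `∏_{w ∣ v} L_w` («three stable conjugacy classes in
`H` which transfer to `γ₀`» on type `(E¹)³`, one on the other compact type) — LEAD T14-40 fence (α) discharged as a theorem, the same count for every `i` and every `G`-regular
`s ∈ T`. [cite: Rogawski1990, §5.4 p. 78; §3.7 Prop. 3.7.1 p. 31; §12.5 Prop. 12.5.2 p. 185] [cite: LanglandsShelstad1987, §1.3] -/
theorem hcQ_of_slotClauses
    (SH : Finset (Subgroup ((UnitaryGroup.cmDatum L 2 (Matrix.of fun i j : Fin 2 => if i.val + j.val + 1 = 2 then (1 : L) else 0)).Local v × (UnitaryGroup.cmDatum L 1 (Matrix.of fun i j : Fin 1 => if i.val + j.val + 1 = 1 then (1 : L) else 0)).Local v)))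
    (n : Subgroup ((UnitaryGroup.cmDatum L 2 (Matrix.of fun i j : Fin 2 => if i.val + j.val + 1 = 2 then (1 : L) else 0)).Local v × (UnitaryGroup.cmDatum L 1 (Matrix.of fun i j : Fin 1 => if i.val + j.val + 1 = 1 then (1 : L) else 0)).Local v) → ℕ)
    (γc : (T : Subgroup ((UnitaryGroup.cmDatum L 2 (Matrix.of fun i j : Fin 2 => if i.val + j.val + 1 = 2 then (1 : L) else 0)).Local v × (UnitaryGroup.cmDatum L 1 (Matrix.of fun i j : Fin 1 => if i.val + j.val + 1 = 1 then (1 : L) else 0)).Local v)) → Fin (n T) → Gqs L v)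
    (eT : (T : Subgroup ((UnitaryGroup.cmDatum L 2 (Matrix.of fun i j : Fin 2 => if i.val + j.val + 1 = 2 then (1 : L) else 0)).Local v × (UnitaryGroup.cmDatum L 1 (Matrix.of fun i j : Fin 1 => if i.val + j.val + 1 = 1 then (1 : L) else 0)).Local v)) → (i : Fin (n T)) → (↥T ≃ₜ* ↥(Subgroup.centralizer ({γc T i} : Set (Gqs L v)))))
    (heT : ∀ T ∈ SH, ∀ (i : Fin (n T)) (s : ↥T), IsLocalNormPair L (qsForm L) v s.1 ((eT T i s : ↥(Subgroup.centralizer ({γc T i} : Set (Gqs L v)))) : Gqs L v))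
    (cQ : Subgroup ((UnitaryGroup.cmDatum L 2 (Matrix.of fun i j : Fin 2 => if i.val + j.val + 1 = 2 then (1 : L) else 0)).Local v × (UnitaryGroup.cmDatum L 1 (Matrix.of fun i j : Fin 1 => if i.val + j.val + 1 = 1 then (1 : L) else 0)).Local v) → ℕ) (σ : (T : Subgroup ((UnitaryGroup.cmDatum L 2 (Matrix.of fun i j : Fin 2 => if i.val + j.val + 1 = 2 then (1 : L) else 0)).Local v × (UnitaryGroup.cmDatum L 1 (Matrix.of fun i j : Fin 1 => if i.val + j.val + 1 = 1 then (1 : L) else 0)).Local v)) → Fin (cQ T) → (↥T → ↥T))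
    (hG : ∀ T ∈ SH, ∀ (u : Fin (cQ T)) (s : ↥T), IsLocalGRegular L v (s : ((UnitaryGroup.cmDatum L 2 (Matrix.of fun i j : Fin 2 => if i.val + j.val + 1 = 2 then (1 : L) else 0)).Local v × (UnitaryGroup.cmDatum L 1 (Matrix.of fun i j : Fin 1 => if i.val + j.val + 1 = 1 then (1 : L) else 0)).Local v)) → IsLocalGRegular L v (σ T u s : ((UnitaryGroup.cmDatum L 2 (Matrix.of fun i j : Fin 2 => if i.val + j.val + 1 = 2 then (1 : L) else 0)).Local v × (UnitaryGroup.cmDatum L 1 (Matrix.of fun i j : Fin 1 => if i.val + j.val + 1 = 1 then (1 : L) else 0)).Local v)))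
    (hN : ∀ T ∈ SH, ∀ (u : Fin (cQ T)) (s : ↥T) (γ : Gqs L v), IsLocalNormPair L (qsForm L) v s.1 γ → IsLocalNormPair L (qsForm L) v (σ T u s).1 γ)
    (hD : ∀ T ∈ SH, ∀ (s : ↥T), IsLocalGRegular L v (s : ((UnitaryGroup.cmDatum L 2 (Matrix.of fun i j : Fin 2 => if i.val + j.val + 1 = 2 then (1 : L) else 0)).Local v × (UnitaryGroup.cmDatum L 1 (Matrix.of fun i j : Fin 1 => if i.val + j.val + 1 = 1 then (1 : L) else 0)).Local v)) → ∀ u u' : Fin (cQ T), u ≠ u' → finGammaTwo L v (σ T u s).1 ≠ finGammaTwo L v (σ T u' s).1)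
    (hR : ∀ T ∈ SH, ∀ (s : ↥T), IsLocalGRegular L v (s : ((UnitaryGroup.cmDatum L 2 (Matrix.of fun i j : Fin 2 => if i.val + j.val + 1 = 2 then (1 : L) else 0)).Local v × (UnitaryGroup.cmDatum L 1 (Matrix.of fun i j : Fin 1 => if i.val + j.val + 1 = 1 then (1 : L) else 0)).Local v)) → ∀ r : UnitaryGroup.LocalRing L v,
      (((endoEmbLocal L v s.1).val.val : Matrix (Fin 3) (Fin 3) (UnitaryGroup.LocalRing L v)).charpoly).IsRoot r ↔ ∃ u : Fin (cQ T), finGammaTwo L v (σ T u s).1 = r) :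
    ∀ T ∈ SH, ∀ (i : Fin (n T)) (s : ↥T), IsLocalGRegular L v s.1 →
      ∃ Q : Finset ((UnitaryGroup.cmDatum L 2 (Matrix.of fun i j : Fin 2 => if i.val + j.val + 1 = 2 then (1 : L) else 0)).Local v × (UnitaryGroup.cmDatum L 1 (Matrix.of fun i j : Fin 1 => if i.val + j.val + 1 = 1 then (1 : L) else 0)).Local v), (∀ q ∈ Q, IsLocalGRegular L v q ∧ IsLocalNormPair L (qsForm L) v q ((eT T i s : ↥(Subgroup.centralizer ({γc T i} : Set (Gqs L v)))) : Gqs L v)) ∧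
        (∀ q ∈ Q, ∀ q' ∈ Q, IsLocalStablyConjH L v q q' → q = q') ∧
        (∀ a : ((UnitaryGroup.cmDatum L 2 (Matrix.of fun i j : Fin 2 => if i.val + j.val + 1 = 2 then (1 : L) else 0)).Local v × (UnitaryGroup.cmDatum L 1 (Matrix.of fun i j : Fin 1 => if i.val + j.val + 1 = 1 then (1 : L) else 0)).Local v), IsLocalGRegular L v a → IsLocalNormPair L (qsForm L) v a ((eT T i s : ↥(Subgroup.centralizer ({γc T i} : Set (Gqs L v)))) : Gqs L v) → ∃ q ∈ Q, IsLocalStablyConjH L v a q) ∧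
        Q.card = cQ T :=
  hcQ_of_slots L v SH n γc eT cQ σ hG (hσR_of_slotClauseN L v SH n γc eT heT cQ σ hN) (hσpair_of_slotClauseD L v SH cQ σ hD)
    (hσexh_of_slotClauseR L v SH n γc eT heT cQ σ hN hR)

/-! ## §5 (ED. 2, append-only) The same with (E2b)'s re-lettered clause (N′) — `G`-regularity antecedent BEFORE `γ` (F0P3a-p03 2026-09-02T20:34:44Z:
off the `G`-regular set `IsLocalNormPair` is not decided by the characteristic polynomial, so the honest slot clause is the regular one) -/

/-- **`hσR` FROM (N′)** (the `G`-regular form of (N): `∀ T ∈ SH, ∀ u s, IsLocalGRegular ↑s → ∀ γ, s.1 → γ ⇒ (σ T u s).1 → γ`); `s` matches `eT T i s` by `heT`.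
[cite: Rogawski1990, §4.3 (4.3.1) p. 43] -/
theorem hσR_of_slotClauseN'
    (SH : Finset (Subgroup ((UnitaryGroup.cmDatum L 2 (Matrix.of fun i j : Fin 2 => if i.val + j.val + 1 = 2 then (1 : L) else 0)).Local v × (UnitaryGroup.cmDatum L 1 (Matrix.of fun i j : Fin 1 => if i.val + j.val + 1 = 1 then (1 : L) else 0)).Local v)))
    (n : Subgroup ((UnitaryGroup.cmDatum L 2 (Matrix.of fun i j : Fin 2 => if i.val + j.val + 1 = 2 then (1 : L) else 0)).Local v × (UnitaryGroup.cmDatum L 1 (Matrix.of fun i j : Fin 1 => if i.val + j.val + 1 = 1 then (1 : L) else 0)).Local v) → ℕ)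
    (γc : (T : Subgroup ((UnitaryGroup.cmDatum L 2 (Matrix.of fun i j : Fin 2 => if i.val + j.val + 1 = 2 then (1 : L) else 0)).Local v × (UnitaryGroup.cmDatum L 1 (Matrix.of fun i j : Fin 1 => if i.val + j.val + 1 = 1 then (1 : L) else 0)).Local v)) → Fin (n T) → Gqs L v)
    (eT : (T : Subgroup ((UnitaryGroup.cmDatum L 2 (Matrix.of fun i j : Fin 2 => if i.val + j.val + 1 = 2 then (1 : L) else 0)).Local v × (UnitaryGroup.cmDatum L 1 (Matrix.of fun i j : Fin 1 => if i.val + j.val + 1 = 1 then (1 : L) else 0)).Local v)) → (i : Fin (n T)) → (↥T ≃ₜ* ↥(Subgroup.centralizer ({γc T i} : Set (Gqs L v)))))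
    (heT : ∀ T ∈ SH, ∀ (i : Fin (n T)) (s : ↥T), IsLocalNormPair L (qsForm L) v s.1 ((eT T i s : ↥(Subgroup.centralizer ({γc T i} : Set (Gqs L v)))) : Gqs L v))
    (cQ : Subgroup ((UnitaryGroup.cmDatum L 2 (Matrix.of fun i j : Fin 2 => if i.val + j.val + 1 = 2 then (1 : L) else 0)).Local v × (UnitaryGroup.cmDatum L 1 (Matrix.of fun i j : Fin 1 => if i.val + j.val + 1 = 1 then (1 : L) else 0)).Local v) → ℕ) (σ : (T : Subgroup ((UnitaryGroup.cmDatum L 2 (Matrix.of fun i j : Fin 2 => if i.val + j.val + 1 = 2 then (1 : L) else 0)).Local v × (UnitaryGroup.cmDatum L 1 (Matrix.of fun i j : Fin 1 => if i.val + j.val + 1 = 1 then (1 : L) else 0)).Local v)) → Fin (cQ T) → (↥T → ↥T))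
    (hN' : ∀ T ∈ SH, ∀ (u : Fin (cQ T)) (s : ↥T), IsLocalGRegular L v (s : ((UnitaryGroup.cmDatum L 2 (Matrix.of fun i j : Fin 2 => if i.val + j.val + 1 = 2 then (1 : L) else 0)).Local v × (UnitaryGroup.cmDatum L 1 (Matrix.of fun i j : Fin 1 => if i.val + j.val + 1 = 1 then (1 : L) else 0)).Local v)) → ∀ γ : Gqs L v, IsLocalNormPair L (qsForm L) v s.1 γ → IsLocalNormPair L (qsForm L) v (σ T u s).1 γ) :
    ∀ T ∈ SH, ∀ (u : Fin (cQ T)) (i : Fin (n T)) (s : ↥T), IsLocalGRegular L v (s : ((UnitaryGroup.cmDatum L 2 (Matrix.of fun i j : Fin 2 => if i.val + j.val + 1 = 2 then (1 : L) else 0)).Local v × (UnitaryGroup.cmDatum L 1 (Matrix.of fun i j : Fin 1 => if i.val + j.val + 1 = 1 then (1 : L) else 0)).Local v)) → IsLocalNormPair L (qsForm L) v (σ T u s).1 ((eT T i s : ↥(Subgroup.centralizer ({γc T i} : Set (Gqs L v)))) : Gqs L v) :=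
  fun T hT u i s hs => hN' T hT u s hs _ (heT T hT i s)

/-- **`hσexh` FROM (R) + (N′)** (as `hσexh_of_slotClauseR`, with the `G`-regular slot clause (N′)). [cite: Rogawski1990, §5.4 p. 78; §4.3 (4.3.1) p. 43] [cite: LanglandsShelstad1987, §1.3] -/
theorem hσexh_of_slotClauseR'
    (SH : Finset (Subgroup ((UnitaryGroup.cmDatum L 2 (Matrix.of fun i j : Fin 2 => if i.val + j.val + 1 = 2 then (1 : L) else 0)).Local v × (UnitaryGroup.cmDatum L 1 (Matrix.of fun i j : Fin 1 => if i.val + j.val + 1 = 1 then (1 : L) else 0)).Local v)))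
    (n : Subgroup ((UnitaryGroup.cmDatum L 2 (Matrix.of fun i j : Fin 2 => if i.val + j.val + 1 = 2 then (1 : L) else 0)).Local v × (UnitaryGroup.cmDatum L 1 (Matrix.of fun i j : Fin 1 => if i.val + j.val + 1 = 1 then (1 : L) else 0)).Local v) → ℕ)
    (γc : (T : Subgroup ((UnitaryGroup.cmDatum L 2 (Matrix.of fun i j : Fin 2 => if i.val + j.val + 1 = 2 then (1 : L) else 0)).Local v × (UnitaryGroup.cmDatum L 1 (Matrix.of fun i j : Fin 1 => if i.val + j.val + 1 = 1 then (1 : L) else 0)).Local v)) → Fin (n T) → Gqs L v)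
    (eT : (T : Subgroup ((UnitaryGroup.cmDatum L 2 (Matrix.of fun i j : Fin 2 => if i.val + j.val + 1 = 2 then (1 : L) else 0)).Local v × (UnitaryGroup.cmDatum L 1 (Matrix.of fun i j : Fin 1 => if i.val + j.val + 1 = 1 then (1 : L) else 0)).Local v)) → (i : Fin (n T)) → (↥T ≃ₜ* ↥(Subgroup.centralizer ({γc T i} : Set (Gqs L v)))))
    (heT : ∀ T ∈ SH, ∀ (i : Fin (n T)) (s : ↥T), IsLocalNormPair L (qsForm L) v s.1 ((eT T i s : ↥(Subgroup.centralizer ({γc T i} : Set (Gqs L v)))) : Gqs L v))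
    (cQ : Subgroup ((UnitaryGroup.cmDatum L 2 (Matrix.of fun i j : Fin 2 => if i.val + j.val + 1 = 2 then (1 : L) else 0)).Local v × (UnitaryGroup.cmDatum L 1 (Matrix.of fun i j : Fin 1 => if i.val + j.val + 1 = 1 then (1 : L) else 0)).Local v) → ℕ) (σ : (T : Subgroup ((UnitaryGroup.cmDatum L 2 (Matrix.of fun i j : Fin 2 => if i.val + j.val + 1 = 2 then (1 : L) else 0)).Local v × (UnitaryGroup.cmDatum L 1 (Matrix.of fun i j : Fin 1 => if i.val + j.val + 1 = 1 then (1 : L) else 0)).Local v)) → Fin (cQ T) → (↥T → ↥T))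
    (hN' : ∀ T ∈ SH, ∀ (u : Fin (cQ T)) (s : ↥T), IsLocalGRegular L v (s : ((UnitaryGroup.cmDatum L 2 (Matrix.of fun i j : Fin 2 => if i.val + j.val + 1 = 2 then (1 : L) else 0)).Local v × (UnitaryGroup.cmDatum L 1 (Matrix.of fun i j : Fin 1 => if i.val + j.val + 1 = 1 then (1 : L) else 0)).Local v)) → ∀ γ : Gqs L v, IsLocalNormPair L (qsForm L) v s.1 γ → IsLocalNormPair L (qsForm L) v (σ T u s).1 γ)
    (hR : ∀ T ∈ SH, ∀ (s : ↥T), IsLocalGRegular L v (s : ((UnitaryGroup.cmDatum L 2 (Matrix.of fun i j : Fin 2 => if i.val + j.val + 1 = 2 then (1 : L) else 0)).Local v × (UnitaryGroup.cmDatum L 1 (Matrix.of fun i j : Fin 1 => if i.val + j.val + 1 = 1 then (1 : L) else 0)).Local v)) → ∀ r : UnitaryGroup.LocalRing L v,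
      (((endoEmbLocal L v s.1).val.val : Matrix (Fin 3) (Fin 3) (UnitaryGroup.LocalRing L v)).charpoly).IsRoot r ↔ ∃ u : Fin (cQ T), finGammaTwo L v (σ T u s).1 = r) :
    ∀ T ∈ SH, ∀ (i : Fin (n T)) (s : ↥T), IsLocalGRegular L v (s : ((UnitaryGroup.cmDatum L 2 (Matrix.of fun i j : Fin 2 => if i.val + j.val + 1 = 2 then (1 : L) else 0)).Local v × (UnitaryGroup.cmDatum L 1 (Matrix.of fun i j : Fin 1 => if i.val + j.val + 1 = 1 then (1 : L) else 0)).Local v)) → ∀ a : ((UnitaryGroup.cmDatum L 2 (Matrix.of fun i j : Fin 2 => if i.val + j.val + 1 = 2 then (1 : L) else 0)).Local v × (UnitaryGroup.cmDatum L 1 (Matrix.of fun i j : Fin 1 => if i.val + j.val + 1 = 1 then (1 : L) else 0)).Local v), IsLocalGRegular L v a → IsLocalNormPair L (qsForm L) v a ((eT T i s : ↥(Subgroup.centralizer ({γc T i} : Set (Gqs L v)))) : Gqs L v) →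
      ∃ u : Fin (cQ T), IsLocalStablyConjH L v a (σ T u s).1 := by
  intro T hT i s hs a ha hmatch
  have hroot : (((endoEmbLocal L v s.1).val.val : Matrix (Fin 3) (Fin 3) (UnitaryGroup.LocalRing L v)).charpoly).IsRoot (finGammaTwo L v a) := by
    rw [charpoly_endoEmbLocal, ← (heT T hT i s).charpoly_eq]
    exact hmatch.isRoot_finGammaTwo
  obtain ⟨u, hu⟩ := (hR T hT s hs (finGammaTwo L v a)).1 hroot
  exact ⟨u, isLocalStablyConjH_of_isLocalNormPair_of_finGammaTwo_eq L (qsForm L) v ha hmatch (hN' T hT u s hs _ (heT T hT i s)) hu.symm⟩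

/-- **(E2) «FIBRE-ENUM», ONE-STOP FORM over (G)(N′)(D)(R)** — the (E0) letter `hcQ` from the (E2b) ∃-package `⟨cQ, σ, hC, hM, hX, hG, hN, hD, hR⟩` of ★-to-be `exists_slotMaps`
with its re-lettered (N′): `hcQ := hcQ_of_slotClauses' L v SH n γc eT heT cQ σ hG hN hD hR`. [cite: Rogawski1990, §5.4 p. 78; §3.7 Prop. 3.7.1 p. 31; §12.5 Prop. 12.5.2 p. 185]
[cite: LanglandsShelstad1987, §1.3] -/
theorem hcQ_of_slotClauses'
    (SH : Finset (Subgroup ((UnitaryGroup.cmDatum L 2 (Matrix.of fun i j : Fin 2 => if i.val + j.val + 1 = 2 then (1 : L) else 0)).Local v × (UnitaryGroup.cmDatum L 1 (Matrix.of fun i j : Fin 1 => if i.val + j.val + 1 = 1 then (1 : L) else 0)).Local v)))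
    (n : Subgroup ((UnitaryGroup.cmDatum L 2 (Matrix.of fun i j : Fin 2 => if i.val + j.val + 1 = 2 then (1 : L) else 0)).Local v × (UnitaryGroup.cmDatum L 1 (Matrix.of fun i j : Fin 1 => if i.val + j.val + 1 = 1 then (1 : L) else 0)).Local v) → ℕ)
    (γc : (T : Subgroup ((UnitaryGroup.cmDatum L 2 (Matrix.of fun i j : Fin 2 => if i.val + j.val + 1 = 2 then (1 : L) else 0)).Local v × (UnitaryGroup.cmDatum L 1 (Matrix.of fun i j : Fin 1 => if i.val + j.val + 1 = 1 then (1 : L) else 0)).Local v)) → Fin (n T) → Gqs L v)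
    (eT : (T : Subgroup ((UnitaryGroup.cmDatum L 2 (Matrix.of fun i j : Fin 2 => if i.val + j.val + 1 = 2 then (1 : L) else 0)).Local v × (UnitaryGroup.cmDatum L 1 (Matrix.of fun i j : Fin 1 => if i.val + j.val + 1 = 1 then (1 : L) else 0)).Local v)) → (i : Fin (n T)) → (↥T ≃ₜ* ↥(Subgroup.centralizer ({γc T i} : Set (Gqs L v)))))
    (heT : ∀ T ∈ SH, ∀ (i : Fin (n T)) (s : ↥T), IsLocalNormPair L (qsForm L) v s.1 ((eT T i s : ↥(Subgroup.centralizer ({γc T i} : Set (Gqs L v)))) : Gqs L v))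
    (cQ : Subgroup ((UnitaryGroup.cmDatum L 2 (Matrix.of fun i j : Fin 2 => if i.val + j.val + 1 = 2 then (1 : L) else 0)).Local v × (UnitaryGroup.cmDatum L 1 (Matrix.of fun i j : Fin 1 => if i.val + j.val + 1 = 1 then (1 : L) else 0)).Local v) → ℕ) (σ : (T : Subgroup ((UnitaryGroup.cmDatum L 2 (Matrix.of fun i j : Fin 2 => if i.val + j.val + 1 = 2 then (1 : L) else 0)).Local v × (UnitaryGroup.cmDatum L 1 (Matrix.of fun i j : Fin 1 => if i.val + j.val + 1 = 1 then (1 : L) else 0)).Local v)) → Fin (cQ T) → (↥T → ↥T))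
    (hG : ∀ T ∈ SH, ∀ (u : Fin (cQ T)) (s : ↥T), IsLocalGRegular L v (s : ((UnitaryGroup.cmDatum L 2 (Matrix.of fun i j : Fin 2 => if i.val + j.val + 1 = 2 then (1 : L) else 0)).Local v × (UnitaryGroup.cmDatum L 1 (Matrix.of fun i j : Fin 1 => if i.val + j.val + 1 = 1 then (1 : L) else 0)).Local v)) → IsLocalGRegular L v (σ T u s : ((UnitaryGroup.cmDatum L 2 (Matrix.of fun i j : Fin 2 => if i.val + j.val + 1 = 2 then (1 : L) else 0)).Local v × (UnitaryGroup.cmDatum L 1 (Matrix.of fun i j : Fin 1 => if i.val + j.val + 1 = 1 then (1 : L) else 0)).Local v)))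
    (hN' : ∀ T ∈ SH, ∀ (u : Fin (cQ T)) (s : ↥T), IsLocalGRegular L v (s : ((UnitaryGroup.cmDatum L 2 (Matrix.of fun i j : Fin 2 => if i.val + j.val + 1 = 2 then (1 : L) else 0)).Local v × (UnitaryGroup.cmDatum L 1 (Matrix.of fun i j : Fin 1 => if i.val + j.val + 1 = 1 then (1 : L) else 0)).Local v)) → ∀ γ : Gqs L v, IsLocalNormPair L (qsForm L) v s.1 γ → IsLocalNormPair L (qsForm L) v (σ T u s).1 γ)
    (hD : ∀ T ∈ SH, ∀ (s : ↥T), IsLocalGRegular L v (s : ((UnitaryGroup.cmDatum L 2 (Matrix.of fun i j : Fin 2 => if i.val + j.val + 1 = 2 then (1 : L) else 0)).Local v × (UnitaryGroup.cmDatum L 1 (Matrix.of fun i j : Fin 1 => if i.val + j.val + 1 = 1 then (1 : L) else 0)).Local v)) → ∀ u u' : Fin (cQ T), u ≠ u' → finGammaTwo L v (σ T u s).1 ≠ finGammaTwo L v (σ T u' s).1)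
    (hR : ∀ T ∈ SH, ∀ (s : ↥T), IsLocalGRegular L v (s : ((UnitaryGroup.cmDatum L 2 (Matrix.of fun i j : Fin 2 => if i.val + j.val + 1 = 2 then (1 : L) else 0)).Local v × (UnitaryGroup.cmDatum L 1 (Matrix.of fun i j : Fin 1 => if i.val + j.val + 1 = 1 then (1 : L) else 0)).Local v)) → ∀ r : UnitaryGroup.LocalRing L v,
      (((endoEmbLocal L v s.1).val.val : Matrix (Fin 3) (Fin 3) (UnitaryGroup.LocalRing L v)).charpoly).IsRoot r ↔ ∃ u : Fin (cQ T), finGammaTwo L v (σ T u s).1 = r) :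
    ∀ T ∈ SH, ∀ (i : Fin (n T)) (s : ↥T), IsLocalGRegular L v s.1 →
      ∃ Q : Finset ((UnitaryGroup.cmDatum L 2 (Matrix.of fun i j : Fin 2 => if i.val + j.val + 1 = 2 then (1 : L) else 0)).Local v × (UnitaryGroup.cmDatum L 1 (Matrix.of fun i j : Fin 1 => if i.val + j.val + 1 = 1 then (1 : L) else 0)).Local v), (∀ q ∈ Q, IsLocalGRegular L v q ∧ IsLocalNormPair L (qsForm L) v q ((eT T i s : ↥(Subgroup.centralizer ({γc T i} : Set (Gqs L v)))) : Gqs L v)) ∧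
        (∀ q ∈ Q, ∀ q' ∈ Q, IsLocalStablyConjH L v q q' → q = q') ∧
        (∀ a : ((UnitaryGroup.cmDatum L 2 (Matrix.of fun i j : Fin 2 => if i.val + j.val + 1 = 2 then (1 : L) else 0)).Local v × (UnitaryGroup.cmDatum L 1 (Matrix.of fun i j : Fin 1 => if i.val + j.val + 1 = 1 then (1 : L) else 0)).Local v), IsLocalGRegular L v a → IsLocalNormPair L (qsForm L) v a ((eT T i s : ↥(Subgroup.centralizer ({γc T i} : Set (Gqs L v)))) : Gqs L v) → ∃ q ∈ Q, IsLocalStablyConjH L v a q) ∧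
        Q.card = cQ T :=
  hcQ_of_slots L v SH n γc eT cQ σ hG (hσR_of_slotClauseN' L v SH n γc eT heT cQ σ hN') (hσpair_of_slotClauseD L v SH cQ σ hD)
    (hσexh_of_slotClauseR' L v SH n γc eT heT cQ σ hN' hR)


end CM

end Summit.HodgeConjecture.HodgeConjecture.Cruxes.H413.F0P3cStCharTSEllInnerFibreEnum

end
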